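import Literature.MathematicalPhysics.QuantumManyBody.JelliumBoseGas
import Mathlib.Probability.Distributions.Beta
import Mathlib.MeasureTheory.Function.JacobianOneDim
import Mathlib.Analysis.SpecialFunctions.Sqrt
import HarnessLib

/-!
# The Foldy–Bogoliubov integral `∫₀^∞ (1 + x⁴ − x²√(x⁴+2)) dx = (2/5)·2^{-1/4}√π·Γ(3/4)/Γ(5/4)`

Topic `Literature/MathematicalPhysics/QuantumManyBody`, companion of `JelliumBoseGas.lean`
(provefact `Literature.MathematicalPhysics.QuantumManyBody.JelliumBoseGas.foldyLaw`,
[LSSY2005, Thm. 10.1]). Bogoliubov's method (summing the two-mode bounds of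
`BogoliubovSimpleMethod.lean` over momenta) delivers the jellium correlation energy through the
integral `J = ∫₀^∞ (1 + x⁴ − x²√(x⁴+2)) dx` ([LiebSolovej2001, display after Thm. 1.1]:
`A = π⁻¹6^{1/4}∫₀^∞{p²(p⁴+2)^{1/2} − p⁴ − 1}dp ≈ −0.40154`; [Solovej2006, (2)]:
`I₀ = (2/π)^{3/4}∫₀^∞(1 + x⁴ − x²(x⁴+2)^{1/2})dx`), whereas [LSSY2005, (10.2)] and the tree's
`foldyConstant` give the closed Gamma-function form. This file PROVES the identification:

* `lintegral_Ioo_rpow_mul_one_sub_rpow` — Euler's Beta integral `∫₀¹ x^{α-1}(1-x)^{β-1}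
  = Γ(α)Γ(β)/Γ(α+β)` in `ℝ≥0∞` (read off Mathlib's Beta distribution);
* `foldyIntegrand_eq` (`1 + x⁴ − x²√(x⁴+2) = 2/(x²+√(x⁴+2))² > 0`), `foldyIntegrand_subst`,
  `hasDerivAt_foldySubst`, `foldySubst_jacobian` — the substitution `x = √(1−w)/(2w)^{1/4}`,
  `w ∈ (0,1)` (inverse `w = 2/(x²+√(x⁴+2))²`), under which the integrand becomes `w` and
  `|dx/dw| · w = 2^{-1/4}/4 · (w^{-1/4} + w^{3/4})(1−w)^{-1/2}`;
* `lintegral_foldyIntegrand`, `integral_foldyIntegrand` — **`J = (2/5)·2^{-1/4}·√π·Γ(3/4)/Γ(5/4)`**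
  (`≈ 0.80600`), with integrability on `(0, ∞)` (change of variables by
  `MeasureTheory.lintegral_image_eq_lintegral_abs_deriv_mul`, then `B(3/4,½) + B(7/4,½) = (8/5)B(3/4,½)`);
* `foldyConstant_eq_integral` — **`foldyConstant = √2 · π^{-3/4} · J`**.

## References

* [LSSY2005] E. H. Lieb, R. Seiringer, J. P. Solovej, J. Yngvason, *The Mathematics of the Bose
  Gas and its Condensation* (2005), Thm. 10.1 with (10.2).
* [LiebSolovej2001] E. H. Lieb, J. P. Solovej, Commun. Math. Phys. 217 (2001) 127–163
  (arXiv:cond-mat/0007425 p. 3), Thm. 1.1 and the integral `A` displayed after it.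
* [Solovej2006] J. P. Solovej, Commun. Math. Phys. 266 (2006) 797–818, Thm. 1.1, (2).
-/

noncomputable section

open MeasureTheory Set Real
open scoped ENNReal

namespace Literature.MathematicalPhysics.QuantumManyBody.JelliumBoseGas

/-! ### Euler's Beta integral in `ℝ≥0∞` -/

/-- **Euler's Beta integral** (real parameters, `ℝ≥0∞` form): for `α, β > 0`,
`∫⁻_{(0,1)} x^{α-1}(1-x)^{β-1} dx = Γ(α)Γ(β)/Γ(α+β)` — read off Mathlib's normalisation of the
Beta distribution (`ProbabilityTheory.lintegral_betaPDF_eq_one`). [folklore] -/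
theorem lintegral_Ioo_rpow_mul_one_sub_rpow {α β : ℝ} (hα : 0 < α) (hβ : 0 < β) :
    ∫⁻ x in Ioo (0 : ℝ) 1, ENNReal.ofReal (x ^ (α - 1) * (1 - x) ^ (β - 1)) =
      ENNReal.ofReal (Real.Gamma α * Real.Gamma β / Real.Gamma (α + β)) := by
  have hB : 0 < ProbabilityTheory.beta α β := ProbabilityTheory.beta_pos hα hβ
  have h1 := ProbabilityTheory.lintegral_betaPDF_eq_one hα hβ
  rw [ProbabilityTheory.lintegral_betaPDF] at h1
  have h2 : ∀ x : ℝ, ENNReal.ofReal (1 / ProbabilityTheory.beta α β * x ^ (α - 1) *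
      (1 - x) ^ (β - 1)) = ENNReal.ofReal (1 / ProbabilityTheory.beta α β) *
        ENNReal.ofReal (x ^ (α - 1) * (1 - x) ^ (β - 1)) := fun x => by
    rw [mul_assoc, ENNReal.ofReal_mul (one_div_pos.2 hB).le]
  simp_rw [h2] at h1
  rw [lintegral_const_mul' _ _ ENNReal.ofReal_ne_top] at h1
  set c : ℝ≥0∞ := ENNReal.ofReal (1 / ProbabilityTheory.beta α β) with hc
  have hc0 : c ≠ 0 := (ENNReal.ofReal_pos.2 (one_div_pos.2 hB)).ne'
  have hctop : c ≠ ⊤ := ENNReal.ofReal_ne_top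
  calc ∫⁻ x in Ioo (0 : ℝ) 1, ENNReal.ofReal (x ^ (α - 1) * (1 - x) ^ (β - 1))
      = c⁻¹ * (c * ∫⁻ x in Ioo (0 : ℝ) 1, ENNReal.ofReal (x ^ (α - 1) * (1 - x) ^ (β - 1))) := by
        rw [← mul_assoc, ENNReal.inv_mul_cancel hc0 hctop, one_mul]
    _ = c⁻¹ := by rw [h1, mul_one]
    _ = ENNReal.ofReal (Real.Gamma α * Real.Gamma β / Real.Gamma (α + β)) := by
        rw [hc, one_div, ENNReal.ofReal_inv_of_pos hB, inv_inv]
        rfl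

/-! ### The substitution `x = √(1-w) / (2w)^{1/4}` -/

/-- The integrand of the Foldy–Bogoliubov integral is a perfect square over a square:
`1 + x⁴ − x²√(x⁴+2) = 2/(x² + √(x⁴+2))²` (so it is positive). [folklore] -/
theorem foldyIntegrand_eq (x : ℝ) :
    1 + x ^ 4 - x ^ 2 * Real.sqrt (x ^ 4 + 2) = 2 / (x ^ 2 + Real.sqrt (x ^ 4 + 2)) ^ 2 := by
  set r : ℝ := Real.sqrt (x ^ 4 + 2) with hr
  have hr0 : 0 < r := Real.sqrt_pos.2 (by positivity)
  have hr2 : r ^ 2 = x ^ 4 + 2 := Real.sq_sqrt (by positivity)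
  have hden : 0 < x ^ 2 + r := by positivity
  have hprod : (r - x ^ 2) * (r + x ^ 2) = 2 := by nlinarith
  have h1 : 1 + x ^ 4 - x ^ 2 * r = (r - x ^ 2) ^ 2 / 2 := by nlinarith
  rw [h1]
  have h2 : r - x ^ 2 = 2 / (x ^ 2 + r) := by
    field_simp
    linarith
  rw [h2]
  field_simp

/-- The integrand is positive. [folklore] -/
theorem foldyIntegrand_pos (x : ℝ) : 0 < 1 + x ^ 4 - x ^ 2 * Real.sqrt (x ^ 4 + 2) := by
  rw [foldyIntegrand_eq]
  have : 0 < x ^ 2 + Real.sqrt (x ^ 4 + 2) := by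
    have := Real.sqrt_pos.2 (show (0:ℝ) < x ^ 4 + 2 by positivity)
    positivity
  positivity

/-- On the substitution `x = √(1-w)/√(√(2w))`, `0 < w < 1`: the integrand becomes `w`. [folklore] -/
theorem foldyIntegrand_subst {w : ℝ} (hw : w ∈ Ioo (0 : ℝ) 1) :
    let x : ℝ := Real.sqrt (1 - w) / Real.sqrt (Real.sqrt (2 * w))
    1 + x ^ 4 - x ^ 2 * Real.sqrt (x ^ 4 + 2) = w := by
  intro x
  obtain ⟨hw0, hw1⟩ := hw
  set r : ℝ := Real.sqrt (2 * w) with hr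
  set q : ℝ := Real.sqrt r with hq
  have hr0 : 0 < r := Real.sqrt_pos.2 (by positivity)
  have hr2 : r ^ 2 = 2 * w := Real.sq_sqrt (by positivity)
  have hq0 : 0 < q := Real.sqrt_pos.2 hr0
  have hq2 : q ^ 2 = r := Real.sq_sqrt hr0.le
  have hc2 : Real.sqrt (1 - w) ^ 2 = 1 - w := Real.sq_sqrt (by linarith)
  -- `x² = (1-w)/r`
  have hx2 : x ^ 2 = (1 - w) / r := by
    show (Real.sqrt (1 - w) / q) ^ 2 = (1 - w) / r
    rw [div_pow, hc2, hq2]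
  have hx4 : x ^ 4 = (1 - w) ^ 2 / r ^ 2 := by
    rw [show x ^ 4 = (x ^ 2) ^ 2 by ring, hx2, div_pow]
  -- `√(x⁴ + 2) = (1+w)/r`
  have hsq : Real.sqrt (x ^ 4 + 2) = (1 + w) / r := by
    rw [hx4, show (1 - w) ^ 2 / r ^ 2 + 2 = ((1 + w) / r) ^ 2 by
      rw [div_pow]; field_simp; nlinarith [hr2]]
    exact Real.sqrt_sq (by positivity)
  rw [hsq, hx4, hx2]
  field_simp
  nlinarith [hr2]

/-- The derivative of the substitution map `φ(w) = √(1-w)/√(√(2w))` on `(0,1)`: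
`φ'(w) = -(1+w) / (2 √(1-w) · √(2w) · √(√(2w))³)`. [folklore] -/
theorem hasDerivAt_foldySubst {w : ℝ} (hw : w ∈ Ioo (0 : ℝ) 1) :
    HasDerivAt (fun w : ℝ => Real.sqrt (1 - w) / Real.sqrt (Real.sqrt (2 * w)))
      (-(1 + w) / (2 * Real.sqrt (1 - w) * Real.sqrt (2 * w) * Real.sqrt (Real.sqrt (2 * w)) ^ 3))
      w := by
  obtain ⟨hw0, hw1⟩ := hw
  set r : ℝ := Real.sqrt (2 * w) with hr
  set q : ℝ := Real.sqrt r with hq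
  set c : ℝ := Real.sqrt (1 - w) with hc
  have hr0 : 0 < r := Real.sqrt_pos.2 (by positivity)
  have hr2 : r ^ 2 = 2 * w := Real.sq_sqrt (by positivity)
  have hq0 : 0 < q := Real.sqrt_pos.2 hr0
  have hq2 : q ^ 2 = r := Real.sq_sqrt hr0.le
  have hc0 : 0 < c := Real.sqrt_pos.2 (by linarith)
  have hc2 : c ^ 2 = 1 - w := Real.sq_sqrt (by linarith)
  -- numerator `c(w) = √(1-w)`
  have hnum : HasDerivAt (fun w : ℝ => Real.sqrt (1 - w)) (-1 / (2 * c)) w := by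
    have h : HasDerivAt (fun w : ℝ => 1 - w) (-1) w := (hasDerivAt_id' w).const_sub 1
    exact (h.sqrt (show (1:ℝ) - w ≠ 0 by linarith)).congr_deriv (by rw [← hc])
  -- denominator `q(w) = √(√(2w))`
  have hden : HasDerivAt (fun w : ℝ => Real.sqrt (Real.sqrt (2 * w))) (1 / (2 * r * q)) w := by
    have h1 : HasDerivAt (fun w : ℝ => 2 * w) (2 * 1) w := (hasDerivAt_id' w).const_mul 2
    have h2 : HasDerivAt (fun w : ℝ => Real.sqrt (2 * w)) (2 * 1 / (2 * Real.sqrt (2 * w))) w :=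
      h1.sqrt (show (2:ℝ) * w ≠ 0 by positivity)
    have h3 := h2.sqrt (show Real.sqrt (2 * w) ≠ 0 from hr0.ne')
    refine h3.congr_deriv ?_
    rw [← hr, ← hq]
    field_simp
  have h := hnum.fun_div hden (show Real.sqrt (Real.sqrt (2 * w)) ≠ 0 from hq0.ne')
  refine h.congr_deriv ?_
  rw [← hr, ← hq, ← hc]
  field_simp
  -- both sides are polynomials in `c, r, q, w` up to the relations `c² = 1-w`, `q² = r`, `r² = 2w`
  nlinarith [hc2, hq2, hr2, hq0, hr0, hc0]

/-- `φ(w)² = (1-w)/√(2w)` for `0 < w ≤ 1`. [folklore] -/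
theorem foldySubst_sq {w : ℝ} (hw : 0 < w) (hw1 : w ≤ 1) :
    (Real.sqrt (1 - w) / Real.sqrt (Real.sqrt (2 * w))) ^ 2 = (1 - w) / Real.sqrt (2 * w) := by
  have hr0 : 0 < Real.sqrt (2 * w) := Real.sqrt_pos.2 (by positivity)
  rw [div_pow, Real.sq_sqrt (by linarith), Real.sq_sqrt hr0.le]

/-- The Jacobian factor of the substitution, times the transformed integrand `w`, is the Beta-type
density `2^{-1/4}/4 · (w^{-1/4}(1-w)^{-1/2} + w^{3/4}(1-w)^{-1/2})`. [folklore] -/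
theorem foldySubst_jacobian {w : ℝ} (hw : w ∈ Ioo (0 : ℝ) 1) :
    |-(1 + w) / (2 * Real.sqrt (1 - w) * Real.sqrt (2 * w) * Real.sqrt (Real.sqrt (2 * w)) ^ 3)| * w
      = (2 : ℝ) ^ (-(1 / 4 : ℝ)) / 4 *
        (w ^ (-(1 / 4 : ℝ)) * (1 - w) ^ (-(1 / 2 : ℝ)) + w ^ (3 / 4 : ℝ) * (1 - w) ^ (-(1 / 2 : ℝ))) := by
  obtain ⟨hw0, hw1⟩ := hw
  set r : ℝ := Real.sqrt (2 * w) with hr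
  set q : ℝ := Real.sqrt r with hq
  set c : ℝ := Real.sqrt (1 - w) with hc
  have hr0 : 0 < r := Real.sqrt_pos.2 (by positivity)
  have hr2 : r ^ 2 = 2 * w := Real.sq_sqrt (by positivity)
  have hq0 : 0 < q := Real.sqrt_pos.2 hr0
  have hq2 : q ^ 2 = r := Real.sq_sqrt hr0.le
  have hc0 : 0 < c := Real.sqrt_pos.2 (by linarith)
  -- left side `= (1+w)/(4 c q)`
  have hL : |-(1 + w) / (2 * c * r * q ^ 3)| * w = (1 + w) / (4 * c * q) := by
    rw [abs_div, abs_neg, abs_of_pos (by linarith : 0 < 1 + w), abs_of_pos (by positivity)]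
    have hrq : r * q ^ 3 = 2 * w * q := by
      calc r * q ^ 3 = r * q ^ 2 * q := by ring
        _ = r * r * q := by rw [hq2]
        _ = 2 * w * q := by rw [← hr2]; ring
    field_simp
    nlinarith [hrq]
  rw [hL]
  -- right side: `w^{3/4} = w · w^{-1/4}`, `c = (1-w)^{1/2}`, `q = (2w)^{1/4} = 2^{1/4} w^{1/4}`
  have e1 : w ^ (3 / 4 : ℝ) = w * w ^ (-(1 / 4 : ℝ)) := by
    rw [show (3 / 4 : ℝ) = 1 + -(1 / 4) by norm_num, Real.rpow_add hw0, Real.rpow_one]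
  have e2 : c = (1 - w) ^ (1 / 2 : ℝ) := by rw [hc, Real.sqrt_eq_rpow]
  have e3 : q = (2 : ℝ) ^ (1 / 4 : ℝ) * w ^ (1 / 4 : ℝ) := by
    rw [hq, hr, Real.sqrt_eq_rpow, Real.sqrt_eq_rpow, ← Real.rpow_mul (by positivity),
      Real.mul_rpow (by norm_num) hw0.le]
    norm_num
  have e4 : (1 - w) ^ (-(1 / 2 : ℝ)) = ((1 - w) ^ (1 / 2 : ℝ))⁻¹ := Real.rpow_neg (by linarith) _
  have e5 : w ^ (-(1 / 4 : ℝ)) = (w ^ (1 / 4 : ℝ))⁻¹ := Real.rpow_neg hw0.le _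
  have e6 : (2 : ℝ) ^ (-(1 / 4 : ℝ)) = ((2 : ℝ) ^ (1 / 4 : ℝ))⁻¹ := Real.rpow_neg (by norm_num) _
  have h2pos : 0 < (2 : ℝ) ^ (1 / 4 : ℝ) := Real.rpow_pos_of_pos (by norm_num) _
  have hw4 : 0 < w ^ (1 / 4 : ℝ) := Real.rpow_pos_of_pos hw0 _
  have hcw : 0 < (1 - w) ^ (1 / 2 : ℝ) := Real.rpow_pos_of_pos (by linarith) _
  rw [e1, e2, e3, e4, e5, e6]
  field_simp

/-- **The Foldy–Bogoliubov integral in `ℝ≥0∞`**: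
`∫⁻₀^∞ (1 + x⁴ − x²√(x⁴+2)) dx = 2^{-1/4}/4 · (B(3/4, 1/2) + B(7/4, 1/2))`, by the substitution
`x = √(1-w)/(2w)^{1/4}` (`w ∈ (0,1)`, inverse `w = 2/(x²+√(x⁴+2))²`) and Euler's Beta integral.
[folklore] -/
theorem lintegral_foldyIntegrand :
    ∫⁻ x in Ioi (0 : ℝ), ENNReal.ofReal (1 + x ^ 4 - x ^ 2 * Real.sqrt (x ^ 4 + 2)) =
      ENNReal.ofReal ((2 : ℝ) ^ (-(1 / 4 : ℝ)) / 4 *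
        (Real.Gamma (3 / 4) * Real.Gamma (1 / 2) / Real.Gamma (5 / 4) +
          Real.Gamma (7 / 4) * Real.Gamma (1 / 2) / Real.Gamma (9 / 4))) := by
  set φ : ℝ → ℝ := fun w => Real.sqrt (1 - w) / Real.sqrt (Real.sqrt (2 * w)) with hφ
  set φ' : ℝ → ℝ := fun w =>
    -(1 + w) / (2 * Real.sqrt (1 - w) * Real.sqrt (2 * w) * Real.sqrt (Real.sqrt (2 * w)) ^ 3)
    with hφ'
  -- positivity and strict antitonicity on `(0, 1)`
  have hφpos : ∀ w ∈ Ioo (0 : ℝ) 1, 0 < φ w := fun w hw =>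
    div_pos (Real.sqrt_pos.2 (by linarith [hw.2]))
      (Real.sqrt_pos.2 (Real.sqrt_pos.2 (by linarith [hw.1])))
  have hanti : StrictAntiOn φ (Ioo (0 : ℝ) 1) := by
    intro a ha b hb hab
    have ha' := hφpos a ha
    have hb' := hφpos b hb
    rw [← sq_lt_sq₀ hb'.le ha'.le]
    show φ b ^ 2 < φ a ^ 2
    rw [hφ]
    simp only
    rw [foldySubst_sq hb.1 hb.2.le, foldySubst_sq ha.1 ha.2.le]
    calc (1 - b) / Real.sqrt (2 * b) < (1 - a) / Real.sqrt (2 * b) :=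
          div_lt_div_of_pos_right (by linarith) (Real.sqrt_pos.2 (by linarith [hb.1]))
      _ < (1 - a) / Real.sqrt (2 * a) :=
          div_lt_div_of_pos_left (by linarith [ha.2]) (Real.sqrt_pos.2 (by linarith [ha.1]))
            (Real.sqrt_lt_sqrt (by linarith [ha.1]) (by linarith))
  -- the image is `(0, ∞)` (explicit inverse `w = 2/(x² + √(x⁴+2))²`)
  have himage : φ '' Ioo (0 : ℝ) 1 = Ioi 0 := by
    apply Subset.antisymm
    · rintro _ ⟨w, hw, rfl⟩
      exact hφpos w hw
    · intro y hy
      have hy0 : 0 < y := hy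
      set rr : ℝ := Real.sqrt (y ^ 4 + 2) with hrr
      have hrr0 : 0 < rr := Real.sqrt_pos.2 (by positivity)
      have hrr2 : rr ^ 2 = y ^ 4 + 2 := Real.sq_sqrt (by positivity)
      set u : ℝ := y ^ 2 + rr with hu
      have hu0 : 0 < u := by positivity
      have hu2 : u ^ 2 - 2 = 2 * y ^ 2 * u := by
        rw [hu]; nlinarith [hrr2]
      have hu2' : 2 < u ^ 2 := by nlinarith
      set w : ℝ := 2 / u ^ 2 with hw
      have hw0 : 0 < w := by positivity
      have hw1 : w < 1 := by rw [hw, div_lt_one (by positivity)]; exact hu2'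
      refine ⟨w, ⟨hw0, hw1⟩, ?_⟩
      -- `φ w = y` via squares
      have hφw : 0 < φ w := hφpos w ⟨hw0, hw1⟩
      rw [← sq_eq_sq₀ hφw.le hy0.le]
      show (Real.sqrt (1 - w) / Real.sqrt (Real.sqrt (2 * w))) ^ 2 = y ^ 2
      rw [foldySubst_sq hw0 hw1.le]
      have hsw : Real.sqrt (2 * w) = 2 / u := by
        rw [hw, show 2 * (2 / u ^ 2) = (2 / u) ^ 2 by ring]
        exact Real.sqrt_sq (by positivity)
      rw [hsw, hw]
      field_simp
      nlinarith [hu2]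
  -- change of variables
  have hderiv : ∀ w ∈ Ioo (0 : ℝ) 1, HasDerivWithinAt φ (φ' w) (Ioo (0 : ℝ) 1) w := fun w hw =>
    (hasDerivAt_foldySubst hw).hasDerivWithinAt
  rw [← himage, lintegral_image_eq_lintegral_abs_deriv_mul measurableSet_Ioo hderiv hanti.injOn]
  -- pointwise: `|φ'(w)| · (integrand at φ w) = Beta-type density`
  have hpt : ∀ w ∈ Ioo (0 : ℝ) 1,
      ENNReal.ofReal |φ' w| * ENNReal.ofReal (1 + φ w ^ 4 - φ w ^ 2 * Real.sqrt (φ w ^ 4 + 2)) =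
        ENNReal.ofReal ((2 : ℝ) ^ (-(1 / 4 : ℝ)) / 4) *
          (ENNReal.ofReal (w ^ ((3 / 4 : ℝ) - 1) * (1 - w) ^ ((1 / 2 : ℝ) - 1)) +
            ENNReal.ofReal (w ^ ((7 / 4 : ℝ) - 1) * (1 - w) ^ ((1 / 2 : ℝ) - 1))) := by
    intro w hw
    have hsub : 1 + φ w ^ 4 - φ w ^ 2 * Real.sqrt (φ w ^ 4 + 2) = w := foldyIntegrand_subst hw
    rw [hsub, ← ENNReal.ofReal_mul (abs_nonneg _)]
    have hj := foldySubst_jacobian hw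
    simp only [hφ'] at hj ⊢
    rw [hj, show (3 / 4 : ℝ) - 1 = -(1 / 4) by norm_num, show (1 / 2 : ℝ) - 1 = -(1 / 2) by norm_num,
      show (7 / 4 : ℝ) - 1 = 3 / 4 by norm_num,
      ENNReal.ofReal_mul (by positivity), ENNReal.ofReal_add
        (mul_nonneg (Real.rpow_nonneg hw.1.le _) (Real.rpow_nonneg (by linarith [hw.2]) _))
        (mul_nonneg (Real.rpow_nonneg hw.1.le _) (Real.rpow_nonneg (by linarith [hw.2]) _))]
  have hm : Measurable fun a : ℝ =>
      ENNReal.ofReal (a ^ ((3 / 4 : ℝ) - 1) * (1 - a) ^ ((1 / 2 : ℝ) - 1)) := by fun_prop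
  rw [setLIntegral_congr_fun measurableSet_Ioo hpt, lintegral_const_mul' _ _ ENNReal.ofReal_ne_top,
    lintegral_add_left hm]
  rw [lintegral_Ioo_rpow_mul_one_sub_rpow (by norm_num : (0:ℝ) < 3 / 4) (by norm_num : (0:ℝ) < 1 / 2),
    lintegral_Ioo_rpow_mul_one_sub_rpow (by norm_num : (0:ℝ) < 7 / 4) (by norm_num : (0:ℝ) < 1 / 2),
    ← ENNReal.ofReal_add (by positivity) (by positivity), ← ENNReal.ofReal_mul (by positivity)]
  norm_num

/-- The Gamma-function bookkeeping: `2^{-1/4}/4 · (B(3/4,1/2) + B(7/4,1/2))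
= (2/5) 2^{-1/4} √π Γ(3/4)/Γ(5/4)` (`Γ(7/4) = ¾Γ(3/4)`, `Γ(9/4) = (5/4)Γ(5/4)`, `Γ(½) = √π`).
[folklore] -/
theorem foldyIntegral_value_eq :
    (2 : ℝ) ^ (-(1 / 4 : ℝ)) / 4 *
        (Real.Gamma (3 / 4) * Real.Gamma (1 / 2) / Real.Gamma (5 / 4) +
          Real.Gamma (7 / 4) * Real.Gamma (1 / 2) / Real.Gamma (9 / 4)) =
      2 / 5 * (2 : ℝ) ^ (-(1 / 4 : ℝ)) * Real.sqrt π * Real.Gamma (3 / 4) / Real.Gamma (5 / 4) := by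
  have h7 : Real.Gamma (7 / 4) = 3 / 4 * Real.Gamma (3 / 4) := by
    rw [show (7 / 4 : ℝ) = 3 / 4 + 1 by norm_num, Real.Gamma_add_one (by norm_num)]
  have h9 : Real.Gamma (9 / 4) = 5 / 4 * Real.Gamma (5 / 4) := by
    rw [show (9 / 4 : ℝ) = 5 / 4 + 1 by norm_num, Real.Gamma_add_one (by norm_num)]
  have h5 : Real.Gamma (5 / 4) ≠ 0 := (Real.Gamma_pos_of_pos (by norm_num)).ne'
  rw [h7, h9, Real.Gamma_one_half_eq]
  field_simp
  ring

/-- **The Foldy–Bogoliubov integral.** `∫₀^∞ (1 + x⁴ − x²√(x⁴+2)) dx = (2/5)·2^{-1/4}·√π·Γ(3/4)/Γ(5/4)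
≈ 0.80600`, the integral through which Bogoliubov's/Foldy's computation of the jellium correlation
energy is expressed ([LiebSolovej2001, the display after Thm. 1.1]:
`A = π⁻¹6^{1/4}∫₀^∞{p²(p⁴+2)^{1/2} − p⁴ − 1}dp ≈ −0.40154`; [Solovej2006, (2)]), evaluated in closed form (substitution
`x = √(1−w)/(2w)^{1/4}`, Euler Beta integrals `B(3/4,½)`, `B(7/4,½)`); the integrand is
integrable on `(0, ∞)`. [cite: LiebSolovej2001, Thm. 1.1 and the displayed integral `A` following it] -/
theorem integral_foldyIntegrand :
    IntegrableOn (fun x : ℝ => 1 + x ^ 4 - x ^ 2 * Real.sqrt (x ^ 4 + 2)) (Ioi 0) ∧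
      ∫ x in Ioi (0 : ℝ), (1 + x ^ 4 - x ^ 2 * Real.sqrt (x ^ 4 + 2)) =
        2 / 5 * (2 : ℝ) ^ (-(1 / 4 : ℝ)) * Real.sqrt π * Real.Gamma (3 / 4) / Real.Gamma (5 / 4) := by
  set F : ℝ → ℝ := fun x => 1 + x ^ 4 - x ^ 2 * Real.sqrt (x ^ 4 + 2) with hF
  have hFc : Continuous F := by
    simp only [hF]
    fun_prop
  have hF0 : 0 ≤ᵐ[volume.restrict (Ioi (0 : ℝ))] F :=
    Filter.Eventually.of_forall fun x => (foldyIntegrand_pos x).le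
  have hFm : AEStronglyMeasurable F (volume.restrict (Ioi (0 : ℝ))) :=
    hFc.aestronglyMeasurable
  have hL := lintegral_foldyIntegrand
  rw [foldyIntegral_value_eq] at hL
  have hV : 0 ≤ 2 / 5 * (2 : ℝ) ^ (-(1 / 4 : ℝ)) * Real.sqrt π * Real.Gamma (3 / 4) /
      Real.Gamma (5 / 4) := by
    have := Real.Gamma_pos_of_pos (show (0:ℝ) < 3 / 4 by norm_num)
    have := Real.Gamma_pos_of_pos (show (0:ℝ) < 5 / 4 by norm_num)
    positivity
  refine ⟨(lintegral_ofReal_ne_top_iff_integrable hFm hF0).1 (by rw [hL]; exact ENNReal.ofReal_ne_top), ?_⟩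
  rw [integral_eq_lintegral_of_nonneg_ae hF0 hFm, hL, ENNReal.toReal_ofReal hV]

/-- **Foldy's constant through the Foldy–Bogoliubov integral**: the tree's
`foldyConstant = (2/5)(Γ(3/4)/Γ(5/4))(2/π)^{1/4}` equals `√2 · π^{-3/4} · ∫₀^∞ (1 + x⁴ − x²√(x⁴+2)) dx`
— the closed form (10.2) of [LSSY2005, Thm. 10.1] against the integral form in which Bogoliubov's
method delivers it. [cite: LSSY2005, Thm. 10.1 (10.2)] -/
theorem foldyConstant_eq_integral :
    foldyConstant = Real.sqrt 2 * π ^ (-(3 / 4 : ℝ)) *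
      ∫ x in Ioi (0 : ℝ), (1 + x ^ 4 - x ^ 2 * Real.sqrt (x ^ 4 + 2)) := by
  rw [integral_foldyIntegrand.2, foldyConstant]
  set t : ℝ := (2 : ℝ) ^ (1 / 4 : ℝ) with ht
  set u : ℝ := π ^ (1 / 4 : ℝ) with hu
  have ht0 : 0 < t := Real.rpow_pos_of_pos (by norm_num) _
  have hu0 : 0 < u := Real.rpow_pos_of_pos Real.pi_pos _
  have e1 : Real.sqrt 2 = t ^ 2 := by
    rw [ht, ← Real.rpow_natCast, ← Real.rpow_mul (by norm_num), Real.sqrt_eq_rpow]; norm_num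
  have e2 : Real.sqrt π = u ^ 2 := by
    rw [hu, ← Real.rpow_natCast, ← Real.rpow_mul Real.pi_pos.le, Real.sqrt_eq_rpow]; norm_num
  have e3 : (2 : ℝ) ^ (-(1 / 4 : ℝ)) = t⁻¹ := Real.rpow_neg (by norm_num) _
  have e4 : π ^ (-(3 / 4 : ℝ)) = (u ^ 3)⁻¹ := by
    rw [Real.rpow_neg Real.pi_pos.le, hu, ← Real.rpow_natCast, ← Real.rpow_mul Real.pi_pos.le]
    norm_num
  have e5 : (2 / π : ℝ) ^ (1 / 4 : ℝ) = t / u := by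
    rw [Real.div_rpow (by norm_num) Real.pi_pos.le]
  have h5 : Real.Gamma (5 / 4) ≠ 0 := (Real.Gamma_pos_of_pos (by norm_num)).ne'
  rw [e1, e2, e3, e4, e5]
  field_simp

end Literature.MathematicalPhysics.QuantumManyBody.JelliumBoseGas
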